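import Mathlib
import Summits.MatrixMultiplication.Statement
import Summits.MatrixMultiplication.MatrixMultiplication.Theorems.GraphEquationsOsculatingRank
import Summits.MatrixMultiplication.MatrixMultiplication.Theorems.GraphEquationsAffineDeflation

/-!
# GraphEquations — JET TRUNCATION: deflation along an affine kernel 2-jet needs no corrections
# (M18b′, decomp-mm-lens-5 g31)

(supports `MultiplicityReduction`, stmt-MatrixMultiplication-27806, hand 1 = BOP′ at `K = 2`.)

The g29/g30 lines attacked rung `K = 2` of bounded-order purification by CORRECTED deflation: the
deflated tests `D_γ t_o` along a constant tangent `γ` leave the ideal `I` of the graph by exactly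
the restriction `ρ_o = (D_γ t_o)|_W`, and computing those corrections is matrix-multiplication-hard
in general (the g30 leaf `CheapRowRestriction`).

This module shows that for Strassen's truncation NO CORRECTION IS NEEDED.  Read the
Leykin–Verschelde–Zhao deflation step (kernel direction as UNKNOWNS `μ`, solved implicitly along the
graph) in Ostrowski's nonscalar model: the implicit solution `μ(a,b)` enters only through its 2-jet
at the base point; its affine part `ξ` is a COST-FREE coefficient field
(`IsNonscalarSeq.derivC_affine`), and its quadratic part `M` never has to be computed — it only has
to EXIST, entering the osculating identity of M18a as the bilinear error absorbed by the old
Jacobian columns.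

* `tensorRank_le_of_jet` — **the engine** (system-free, base point `0`): tests `t_o` vanishing on
  `W_n` in the free span of a nonscalar sequence of length `≤ N`, an affine field `ξ`, data `M` with
  (LIFT) `coeff_{a⊗b}(Σ_q ξ_q r_q(t_o) + Σ_q J₀(o,q) M_q) = 0` (`J₀ = linCoeffC t`), and
  (REG) `J₀ p = 0 ∧ G p ∈ colspace J₀ ⇒ p = 0` (`G = linCoeffC (D_ξ t)`, the polar rows) give
  `R(⟨n,n,n⟩) ≤ 2·(3N)`.
* `EqSystem.JetDeflatableAt y`, `tensorRank_le_of_jetDeflatableAt` (`≤ 6·cost`, any base `y`;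
  translation `τ_y` is free), `EqAdmissibleJet`, `omega_le_of_eqAdmissibleJet`,
  `eqAdmissiblePure_of_eqAdmissibleJet`, `eqAdmissibleRed_of_eqAdmissibleJet`.

What this replaces.  Corrected deflation needed the deflated system to be CORRECT (in `I`); jet
truncation needs only SECOND-ORDER OSCULATION at one point modulo `colspace J₀`, which an affine
field achieves for free wherever the tangent extends to a kernel 2-jet of the Jacobian rows —
e.g. wherever `rank J_C` is maximal (module M18d), in particular generically.

No `sorry`.  Sources: [LeykinVerscheldeZhao2006, Thm. 3.1]; [HauensteinWampler2013, §2];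
[BurgisserClausenShokrollahi1997, §4.1 Rem. (4.3), (4.7), Prop. (14.1), (14.8)]; [Strassen1973].
-/

set_option linter.dupNamespace false

noncomputable section

open scoped BigOperators

namespace Summit.MatrixMultiplication.MatrixMultiplication.Theorems.GraphEquations

open MvPolynomial
open Literature.Computability.AlgebraicComplexity
open Literature.Computability.AlgebraicComplexity.ArithCircuit

variable {n : ℕ}


/-! ## The engine: jet truncation (system-free, base point `0`) -/

/-- The linear `C`-coefficient of `D_ξ t` is the POLAR ROW entry
`Σ_{q'} ξ_{q'}(0)·coeff(c_q c_{q'}-part)`: precisely `coeff_{c_q}(D_ξ t) = coeff 0 (Σ_{q'} ι(ξ_{q'})·∂²t/∂c_q∂c_{q'})`.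
(Identification only; the engine uses `coeff_{c_q}(D_ξ t)` directly.) -/
theorem coeff_single_inr_derivC (ξ : Fin n × Fin n → MvPolynomial (MatMulVars n) ℂ)
    (t : MvPolynomial (GraphVars n) ℂ) (q : Fin n × Fin n) :
    coeff (Finsupp.single (Sum.inr q : GraphVars n) 1) (derivC ξ t) =
      coeff 0 (∑ q', liftAB n (ξ q') * pderiv (Sum.inr q) (pderiv (Sum.inr q') t)) := by
  have h := coeff_pderiv (i := (Sum.inr q : GraphVars n)) (derivC ξ t) 0
  simp only [zero_add, Finsupp.coe_zero, Pi.zero_apply, Nat.cast_zero, mul_one] at h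
  rw [← h]
  unfold derivC
  rw [map_sum]
  congr 1
  refine Finset.sum_congr rfl fun q' _ => ?_
  rw [pderiv_mul, pderiv_inr_liftAB, zero_mul, zero_add]

/-- **JET TRUNCATION (the engine).**  Let `t_o` (`o < T`) vanish on `W_n` and lie in the cost-free
span of one nonscalar sequence of length `≤ N`; let `ξ` be an AFFINE coefficient field and `M` any
polynomials with (LIFT) the `a ⊗ b`-part of `Σ_q ξ_q r_q(t_o) + Σ_q J₀(o,q) M_q` zero for every `o`
(`J₀ = linCoeffC t`, the `C`-Jacobian at `0`); and suppose (REG) `J₀ p = 0 ∧ G p = J₀ ν ⇒ p = 0`, where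
`G = linCoeffC (D_ξ t)` (the polar rows).  Then `R(⟨n,n,n⟩) ≤ 2·(3N)`. -/
theorem tensorRank_le_of_jet {T N : ℕ} (t : Fin T → MvPolynomial (GraphVars n) ℂ)
    (hvan : ∀ o, ∀ x ∈ mmGraph n, eval x (t o) = 0)
    (hspan : ∃ gs : List (MvPolynomial (GraphVars n) ℂ), IsNonscalarSeq gs ∧ gs.length ≤ N ∧
      ∀ o, t o ∈ freeSpan {q | q ∈ gs})
    (ξ M : Fin n × Fin n → MvPolynomial (MatMulVars n) ℂ)
    (hξ : ∀ q, liftAB n (ξ q) ∈ freeSpan (∅ : Set (MvPolynomial (GraphVars n) ℂ)))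
    (hlift : ∀ o (i j j' l : Fin n),
      coeff (Finsupp.single (Sum.inl (i, j) : MatMulVars n) 1 +
          Finsupp.single (Sum.inr (j', l) : MatMulVars n) 1)
        (∑ q, ξ q * rowPoly (t o) q + ∑ q, C (linCoeffC t o q) * M q) = 0)
    (hreg : ∀ p ν : Fin n × Fin n → ℂ, (linCoeffC t).mulVec p = 0 →
      (linCoeffC fun o => derivC ξ (t o)).mulVec p = (linCoeffC t).mulVec ν → p = 0) :
    tensorRank (matMulTensor ℂ n n n) ≤ 2 * (3 * N) := by
  classical
  -- the enlarged family: old tests and deflated tests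
  set p : Fin T ⊕ Fin T → MvPolynomial (GraphVars n) ℂ := Sum.elim t fun o => derivC ξ (t o)
    with hp
  -- (1) nonscalar length `≤ 3N`
  obtain ⟨gs, hns, hlen, hmem⟩ := hspan
  obtain ⟨gs', hns', hlen', hsub, hD⟩ := IsNonscalarSeq.derivC_affine ξ hξ hns
  have hspan' : ∃ gs' : List (MvPolynomial (GraphVars n) ℂ), IsNonscalarSeq gs' ∧
      gs'.length ≤ 3 * N ∧ ∀ o, p o ∈ freeSpan {q | q ∈ gs'} := by
    refine ⟨gs', hns', hlen'.trans (by omega), fun o => ?_⟩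
    rcases o with o | o
    · exact hsub _ (hmem o)
    · exact hD _ (hmem o)
  -- (2) the error matrix and the bilinear error
  set H : Fin T ⊕ Fin T → Fin n × Fin n → ℂ :=
    Sum.elim (fun _ _ => 0) fun o q => linCoeffC t o q with hH
  set M' : Fin n × Fin n → Fin n × Fin n → Fin n × Fin n → ℂ := fun q a b =>
    coeff (Finsupp.single (Sum.inl a : MatMulVars n) 1 + Finsupp.single (Sum.inr b) 1) (M q)
    with hM'
  -- (3) the osculating identity, row by row
  have hosc : ∀ o (i j j' l : Fin n),
      coeff (Finsupp.single (Sum.inl (Sum.inl (i, j)) : GraphVars n) 1 +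
          Finsupp.single (Sum.inl (Sum.inr (j', l)) : GraphVars n) 1) (p o) =
        -(if j = j' then coeff (Finsupp.single (Sum.inr (i, l) : GraphVars n) 1) (p o) else 0) -
          ∑ r, H o r * M' r (i, j) (j', l) := by
    intro o i j j' l
    rcases o with o | o
    · simp only [hp, hH, Sum.elim_inl, zero_mul, Finset.sum_const_zero, sub_zero]
      exact coeffIdentity n (t o) (hvan o) i j j' l
    · simp only [hp, hH, hM', Sum.elim_inr]
      exact oscId_derivC (t o) ξ M i j j' l (by simpa [linCoeffC] using hlift o i j j' l)
  -- (4) the annihilating left inverse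
  set J : Matrix (Fin T ⊕ Fin T) (Fin n × Fin n) ℂ :=
    Matrix.of fun o q => coeff (Finsupp.single (Sum.inr q : GraphVars n) 1) (p o) with hJ
  have hregJ : ∀ (v : Fin n × Fin n → ℂ) (ν : Fin n × Fin n → ℂ),
      J.mulVec v = (Matrix.of H).mulVec ν → v = 0 := by
    intro v ν h
    have h1 : (linCoeffC t).mulVec v = 0 := by
      funext o
      have := congrFun h (Sum.inl o)
      simpa [hJ, hH, hp, Matrix.mulVec, dotProduct, linCoeffC] using this
    have h2 : (linCoeffC fun o => derivC ξ (t o)).mulVec v = (linCoeffC t).mulVec ν := by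
      funext o
      have := congrFun h (Sum.inr o)
      simpa [hJ, hH, hp, Matrix.mulVec, dotProduct, linCoeffC] using this
    exact hreg v ν h1 h2
  obtain ⟨P, hPJ, hPH⟩ := exists_leftInverse_annihilating J (Matrix.of H) hregJ
  refine tensorRank_le_of_oscId p hspan' H M' hosc (fun c o => P c o) (fun c q => ?_) (fun c r => ?_)
  · have := congrFun (congrFun hPJ c) q
    simpa [Matrix.mul_apply, Matrix.one_apply, hJ] using this
  · have := congrFun (congrFun hPH c) r
    simpa [Matrix.mul_apply] using this

/-! ## Equation systems: jet-deflatable at a base point -/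

namespace EqSystem

/-- **`E` is JET-DEFLATABLE over the base `y`**: in the coordinates translated to the graph point
over `y` (`translate y`, the `W_n`-automorphism `τ_y`, cost-free in Ostrowski's model) there are an
AFFINE field `ξ` and polynomials `M_q` with (LIFT) for the translated tests relative to
`J = J_C(graphPoint y)`, and (REG) for `J` and the polar rows `G = linCoeffC (D_ξ (t ∘ τ_y))`:
`J p = 0 ∧ G p ∈ colspace J ⇒ p = 0`.  (Module M18c: REG holds for every `ξ` through the tangent of
the tree's polar lemma wherever the test ideal is initially isolated to order `2`; module M18d: LIFT
holds wherever `rank J_C` is maximal.) -/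
def JetDeflatableAt (E : EqSystem n) (y : MatMulVars n → ℂ) : Prop :=
  ∃ ξ M : Fin n × Fin n → MvPolynomial (MatMulVars n) ℂ,
    (∀ q, liftAB n (ξ q) ∈ freeSpan (∅ : Set (MvPolynomial (GraphVars n) ℂ))) ∧
    (∀ (o : Fin E.tests.length) (i j j' l : Fin n),
      coeff (Finsupp.single (Sum.inl (i, j) : MatMulVars n) 1 +
          Finsupp.single (Sum.inr (j', l) : MatMulVars n) 1)
        (∑ q, ξ q * rowPoly (translate y (E.testPoly (E.tests.get o))) q +
          ∑ q, C (E.jacobianC (graphPoint y) o q) * M q) = 0) ∧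
    (∀ p ν : Fin n × Fin n → ℂ, (E.jacobianC (graphPoint y)).mulVec p = 0 →
      (linCoeffC fun o : Fin E.tests.length =>
          derivC ξ (translate y (E.testPoly (E.tests.get o)))).mulVec p =
        (E.jacobianC (graphPoint y)).mulVec ν → p = 0)

end EqSystem

/-- The translated tests of a correct system lie in the cost-free span of a nonscalar sequence of
length `≤ cost` (translation is an affine substitution: BCS §4.1 Rem. (4.3)). -/
theorem exists_isNonscalarSeq_translate {E : EqSystem n} (hfan : E.circuit.IsFanInTwo)
    (y : MatMulVars n → ℂ) :
    ∃ gs : List (MvPolynomial (GraphVars n) ℂ), IsNonscalarSeq gs ∧ gs.length ≤ E.cost ∧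
      ∀ o : Fin E.tests.length, translate y (E.testPoly (E.tests.get o)) ∈ freeSpan {q | q ∈ gs} := by
  obtain ⟨gs, hns, hlen, hmem⟩ := exists_isNonscalarSeq_tests E hfan
  obtain ⟨hns', hmem'⟩ :=
    IsNonscalarSeq.aeval_append (θ := shift (graphPoint y)) (hs := []) (shift_mem_freeSpan _)
      isNonscalarSeq_nil hns
  refine ⟨gs.map (MvPolynomial.aeval (shift (graphPoint y))) ++ [], hns', by simpa using hlen,
    fun o => ?_⟩
  rw [translate_eq, ← MvPolynomial.aeval_eq_bind₁]
  exact hmem' _ (hmem o)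

/-- **A correct system jet-deflatable over some base costs `≥ R(⟨n,n,n⟩)/6`.** -/
theorem tensorRank_le_of_jetDeflatableAt {E : EqSystem n} (hE : E.Correct) {y : MatMulVars n → ℂ}
    (h : E.JetDeflatableAt y) : tensorRank (matMulTensor ℂ n n n) ≤ 2 * (3 * E.cost) := by
  obtain ⟨ξ, M, hξ, hlift, hreg⟩ := h
  have hJ : (linCoeffC fun o : Fin E.tests.length => translate y (E.testPoly (E.tests.get o))) =
      E.jacobianC (graphPoint y) := linCoeffC_bind₁_shift E (graphPoint y)
  refine tensorRank_le_of_jet (fun o => translate y (E.testPoly (E.tests.get o)))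
    (fun o x hx => eval_bind₁_shift_eq_zero (graphPoint_mem_mmGraph y)
      (fun z hz => hE.eval_testPoly_eq_zero hz (List.get_mem _ _)) hx)
    (exists_isNonscalarSeq_translate hE.1 y) ξ M hξ (fun o i j j' l => ?_) (fun p ν h1 h2 => ?_)
  · rw [hJ]; exact hlift o i j j' l
  · rw [hJ] at h1 h2; exact hreg p ν h1 h2

/-- `EqAdmissibleJet β`: correct systems of cost `O(n^β)`, jet-deflatable over some base, exist for
all `n ≥ 1`. -/
def EqAdmissibleJet (β : ℝ) : Prop :=
  ∃ c : ℝ, ∀ n : ℕ, 1 ≤ n → ∃ (E : EqSystem n) (y : MatMulVars n → ℂ),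
    E.Correct ∧ E.JetDeflatableAt y ∧ (E.cost : ℝ) ≤ c * (n : ℝ) ^ β

/-- **Cheap jet-deflatable systems force fast multiplication**: `EqAdmissibleJet β → ω ≤ β`. -/
theorem omega_le_of_eqAdmissibleJet {β : ℝ} (h : EqAdmissibleJet β) : omega ℂ ≤ β := by
  obtain ⟨c, hc⟩ := h
  have hmem : β ∈ admissibleExponents ℂ := by
    change (fun n : ℕ => (tensorRank (matMulTensor ℂ n n n) : ℝ)) =O[Filter.atTop]
      fun n : ℕ => (n : ℝ) ^ β
    refine Asymptotics.IsBigO.of_bound (6 * |c|) ?_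
    filter_upwards [Filter.eventually_ge_atTop 1] with n hn
    obtain ⟨E, y, hE, hjet, hcost⟩ := hc n hn
    have h1 := tensorRank_le_of_jetDeflatableAt hE hjet
    rw [Real.norm_of_nonneg (Nat.cast_nonneg _),
      Real.norm_of_nonneg (Real.rpow_nonneg (Nat.cast_nonneg _) _)]
    have h3 : (tensorRank (matMulTensor ℂ n n n) : ℝ) ≤ 6 * (E.cost : ℝ) := by
      have : (tensorRank (matMulTensor ℂ n n n) : ℝ) ≤ ((2 * (3 * E.cost) : ℕ) : ℝ) := by
        exact_mod_cast h1
      simpa [mul_assoc] using this.trans (by push_cast; ring_nf; exact le_rfl)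
    have h4 : c * (n : ℝ) ^ β ≤ |c| * (n : ℝ) ^ β := by
      gcongr; exact le_abs_self c
    nlinarith [h3, hcost, h4, Real.rpow_nonneg (Nat.cast_nonneg n) β]
  exact csInf_le (admissibleExponents_bddBelow ℂ) hmem

/-- **… hence pure systems strictly above `β`.** -/
theorem eqAdmissiblePure_of_eqAdmissibleJet {β : ℝ} (h : EqAdmissibleJet β) {β' : ℝ} (hββ' : β < β') :
    EqAdmissiblePure β' :=
  eqAdmissiblePure_of_idealIso_one
    (eqAdmissibleIdealIso_one_of_omega_lt ((omega_le_of_eqAdmissibleJet h).trans_lt hββ'))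

/-- And reduced systems strictly above `β` (the currency of `MultiplicityReduction`). -/
theorem eqAdmissibleRed_of_eqAdmissibleJet {β : ℝ} (h : EqAdmissibleJet β) {β' : ℝ} (hββ' : β < β') :
    EqAdmissibleRed β' :=
  eqAdmissibleIdealIso_one_iff_red.mp
    (eqAdmissibleIdealIso_one_of_omega_lt ((omega_le_of_eqAdmissibleJet h).trans_lt hββ'))

end Summit.MatrixMultiplication.MatrixMultiplication.Theorems.GraphEquations

end
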